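import Literature.AlgebraicGeometry.Resolution.LogRegularAtlasTranslate
import Literature.Geometry.PolyhedralFans.LinkedRefinementFamilyHolds
import HarnessLib

/-!
# Equivariant Kato 1994 (10.4), chart step: compatible chart monomials for a TRANSLATED atlas,
# constant along the translates

Topic: `Literature/AlgebraicGeometry/Resolution`. `LogRegularResolutionGeneral.lean` (Kato (10.4),
atlas form) produces, for a log regular Zariski fs atlas `𝒜`, chart monomials `s_i ⊆ P_i` read off
the linked regular projective refinement of the family of chart fans ([KempfEtAl1973] Ch. II §2
Thm. 11*, `Fan.linkedRegularRefinementFamily_holds`), compatible on overlaps and with regular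
blow-up charts (`LogRegularAtlas.exists_compatible_regular_charts`). For the EQUIVARIANT theorem
(Illusie–Temkin, ILO 2014 Exp. VIII 3.4.9; Nizioł 2006 Thm. 5.10, proof) one runs the same
construction on the translated atlas `ℬ.translate σ` (`LogRegularAtlasTranslate.lean`: charts
`(σ k)^* φ_i` on `(σ k)⁻¹ U_i`) but needs the monomials of the chart `(i, k)` NOT to depend on
`k` — then the glued ideal sheaf is stable under the `σ k` (file `LogRegularEquivariantIdeal`).
This is arranged on the fan side: the members `(i, k)` of the translated family all have the cone
`σ_i = P_i^∨`, so every link of the translated atlas (between `(i, k)` at `y` and `(j, k')` at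
`y`) is pushed forward to a link between the members `i` and `j` of the ORIGINAL family
(`Fan.FamilyLink.pushforward`, `LogRegularAtlas.translateLinks`, file `LogRegularAtlasTranslate`); the fan theorem is applied to
the original family with this larger link set, and its refinement data are pulled back to the
translates. The rest is the argument of `exists_compatible_regular_charts` verbatim (saturation
step, partners under the link, Kato (10.3) on the charts) — adapted from
`LogRegularResolutionGeneral.lean` (res-L0-w81-pv-2), whose lemmas are reused.

* `LogRegularAtlas.exists_compatible_regular_charts_translate` — **chart monomials `s_i ⊆ P_i`,
  indexed by the ORIGINAL charts, such that on the translated atlas the ideals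
  `((σ k)^* φ_i (s_i))` are compatible on all overlaps and all blow-up charts are regular.**

References: [Kato1994] (9.8), (10.1), (10.3), (10.4); [KempfEtAl1973] Ch. II §1 Def. 5, §2
Thm. 11*; [Niziol2006] Thm. 5.8, Thm. 5.10 (proof); [IllusieTemkin2014ExpVIII] 3.4.9.
-/

noncomputable section

open AlgebraicGeometry CategoryTheory TopologicalSpace Opposite
open PointedCone Literature.Geometry.PolyhedralFans
open scoped Pointwise
open Literature.Combinatorics.Optimization.HilbertBasis (toRat toRat_add toRat_zero toRat_nsmul)

namespace Literature.AlgebraicGeometry.Resolution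

universe u

namespace LogRegularAtlas

variable {X : Scheme.{u}} (ℬ : LogRegularAtlas X) {κ : Type} [Finite κ] [Nonempty κ]
  (σ : κ → Aut X) (hσ : ∀ k, ℬ.RespectsStalkMonoids (σ k))

/-! ## Compatible chart monomials, constant along the translates -/

/-- **Hypothesis `H` of the one-blowing-up criterion for the TRANSLATED atlas, with chart monomials
indexed by the ORIGINAL charts.** For a log regular atlas `ℬ` and a finite family `σ` of
automorphisms respecting its stalk monoids there are nonempty finite `s_i ⊆ P_i` (`i` an original
chart) such that, for the translated atlas `ℬ.translate σ` (charts `(σ k)^* φ_i` on `(σ k)⁻¹ U_i`):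
(2) at every common point `y` of two translated chart domains the germs of `(σ k)^* φ_i (s_i)` and
`(σ k')^* φ_j (s_j)` generate the same ideal of `𝒪_{X,y}`; (3) every localization of every
blow-up chart ring `Γ(X, (σ k)⁻¹U_i)[((σ k)^*φ_i(s_i))/(σ k)^*φ_i(a)]`, `a ∈ s_i`, is regular.
Proof: the linked regular projective refinement ([KempfEtAl1973] II §2 Thm. 11*,
`Fan.linkedRegularRefinementFamily_holds`) of the ORIGINAL family of chart fans with respect to
ALL links of the translated atlas (`translateLinks`), a common Veronese degree, generators of the
degree-`k` pieces; then the compatibility and regularity arguments of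
`LogRegularAtlas.exists_compatible_regular_charts` run on the translated atlas (adapted from
`LogRegularResolutionGeneral.lean`). [cite: Kato1994, (10.4) with (9.8), (10.1), (10.3)]
[cite: KempfEtAl1973, Ch. II §2 Thm. 11*] [cite: Niziol2006, Thm. 5.10 (proof)] -/
theorem exists_compatible_regular_charts_translate :
    ∃ s : ∀ i : ℬ.ι, Finset (ℬ.P i),
      (∀ i, (s i).Nonempty) ∧
      (∀ (i j : ℬ.ι × κ) (y : X) (hi : y ∈ ((ℬ.translate σ hσ).U i : X.Opens))
          (hj : y ∈ ((ℬ.translate σ hσ).U j : X.Opens)),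
        (Ideal.span ((fun p : ℬ.P i.1 => (ℬ.translate σ hσ).φ i (Multiplicative.ofAdd p)) ''
            (s i.1 : Set (ℬ.P i.1)))).map
            (X.presheaf.germ ((ℬ.translate σ hσ).U i : X.Opens) y hi).hom =
          (Ideal.span ((fun p : ℬ.P j.1 => (ℬ.translate σ hσ).φ j (Multiplicative.ofAdd p)) ''
            (s j.1 : Set (ℬ.P j.1)))).map
            (X.presheaf.germ ((ℬ.translate σ hσ).U j : X.Opens) y hj).hom) ∧
      (∀ (i : ℬ.ι × κ), ∀ a ∈ s i.1, ∀ (𝔓 : Ideal (blowupAlgebra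
          (Ideal.span ((fun p : ℬ.P i.1 => (ℬ.translate σ hσ).φ i (Multiplicative.ofAdd p)) ''
            (s i.1 : Set (ℬ.P i.1))))
          ((ℬ.translate σ hσ).φ i (Multiplicative.ofAdd a)))) [𝔓.IsPrime],
        IsRegularLocalRing (Localization.AtPrime 𝔓)) := by
  classical
  -- the fan data of the ORIGINAL charts
  haveI := ℬ.finite
  haveI : Fintype ℬ.ι := Fintype.ofFinite ℬ.ι
  obtain ⟨l, f, hmem, hlink⟩ := Fan.linkedRegularRefinementFamily_holds ℬ.ι ℬ.n ℬ.chartFan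
    ℬ.chartFan_isRational (ℬ.translateLinks σ hσ)
  have hσmem : ∀ i, ℬ.chartCone i ∈ (ℬ.chartFan i).cones := fun i =>
    Fan.mem_ofCone_iff.2 (PointedCone.IsFaceOf.refl _)
  -- the refinements restricted to the top cones, and their support data
  set R : ∀ i, Fan ℚ (Fin (ℬ.n i) → ℚ) := fun i =>
    ((ℬ.chartFan i).starIter (l i)).restrict (ℬ.chartCone i) with hR
  have hsuppR : ∀ i, (R i).support = (LogBlowup.dualCone (ℬ.P i) : Set (Fin (ℬ.n i) → ℚ)) :=
    fun i => ((hmem i).2.2.2.2.2 (hσmem i)).1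
  have hdata := fun i => ((hmem i).2.2.2.2.2 (hσmem i)).2
  choose m hm hmprop using hdata
  have hRreg : ∀ i, (R i).IsRegular := fun i ρ hρ => (hmem i).2.2.1 hρ.1
  -- a common Veronese degree
  have hver₀ := fun i => exists_veronese (R i) (m i)
  choose kf hkf hkver using hver₀
  set k : ℕ := ∏ i, kf i with hk
  have hkpos : 0 < k := Finset.prod_pos fun i _ => hkf i
  have hver : ∀ i, ∀ j : ℕ, 0 < j → ∀ u ∈ piece (R i) (m i) (j * k),
      ∃ us : Fin j → Fin (ℬ.n i) → ℤ, (∀ t, us t ∈ piece (R i) (m i) k) ∧ u = ∑ t, us t := by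
    intro i
    have hc : 0 < ∏ j ∈ Finset.univ.erase i, kf j := Finset.prod_pos fun j _ => hkf j
    have hkeq : k = (∏ j ∈ Finset.univ.erase i, kf j) * kf i := by
      rw [hk, Finset.prod_erase_mul _ _ (Finset.mem_univ i)]
    rw [hkeq]
    exact LogBlowup.veronese_mul (R i) (m i) (hkver i) hc
  -- the chart generators
  have hM2 := fun i => LogBlowup.exists_finset_isOrthantLike_of_isStrictSupport (ℬ.P i) (ℬ.fg i)
    (ℬ.saturated i) (R i) (hsuppR i) (hRreg i) (m i) (hm i) (fun ρ hρ => (hmprop i ρ hρ).1)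
    (fun ρ hρ x hx => (hmprop i ρ hρ).2.1 x hx) hkpos (hver i)
  choose s hsne hsΓ hΓs horth using hM2
  refine ⟨s, hsne, fun i j y hi hj => ?_, fun i a ha 𝔓 _ => ?_⟩
  · -- (2) compatibility
    -- one inclusion, for any ordered pair of charts
    have key : ∀ (i j : ℬ.ι × κ) (hi : y ∈ ((ℬ.translate σ hσ).U i : X.Opens)) (hj : y ∈ ((ℬ.translate σ hσ).U j : X.Opens)),
        ((fun p : ℬ.P i.1 => (X.presheaf.germ ((ℬ.translate σ hσ).U i : X.Opens) y hi).hom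
            ((ℬ.translate σ hσ).φ i (Multiplicative.ofAdd p))) '' (s i.1 : Set (ℬ.P i.1))) *
          (chartStalkMonoid ((ℬ.translate σ hσ).U j : X.Opens) ((ℬ.translate σ hσ).φ j) y hj : Set (X.presheaf.stalk y)) ⊆
        ((fun p : ℬ.P j.1 => (X.presheaf.germ ((ℬ.translate σ hσ).U j : X.Opens) y hj).hom
            ((ℬ.translate σ hσ).φ j (Multiplicative.ofAdd p))) '' (s j.1 : Set (ℬ.P j.1))) *
          (chartStalkMonoid ((ℬ.translate σ hσ).U j : X.Opens) ((ℬ.translate σ hσ).φ j) y hj : Set (X.presheaf.stalk y)) := by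
      intro i j hi hj
      rintro _ ⟨_, ⟨a, ha, rfl⟩, μ, hμ, rfl⟩
      have ha' : a ∈ s i.1 := Finset.mem_coe.1 ha
      obtain ⟨q, hq⟩ := (ℬ.translate σ hσ).exists_rel hi hj a
      -- `q` satisfies the face inequality for chart `j`
      have hqface : ∀ v ∈ LogBlowup.dualCone ((ℬ.translate σ hσ).P j), (∀ g ∈ (ℬ.translate σ hσ).faceAt j y hj, toRat g ⬝ᵥ v = 0) →
          (k : ℚ) * f j.1 v ≤ toRat (q : Fin (ℬ.n j.1) → ℤ) ⬝ᵥ v := by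
        intro v hv hv0
        have hvt : v ∈ (ℬ.translate σ hσ).faceCone j y hj := ⟨hv, hv0⟩
        set w := (ℬ.translate σ hσ).linkMap hj hi v with hw_def
        have hw : w ∈ (ℬ.translate σ hσ).faceCone i y hi := ((ℬ.translate σ hσ).linkAt j i y hj hi).mapsTo v hvt
        have hEw : (ℬ.translate σ hσ).linkMap hi hj w = v := (ℬ.translate σ hσ).linkMap_linkMap hj hi hvt.2
        have hpair := (ℬ.translate σ hσ).linkMap_pairing hi hj hw.2 hq
        rw [hEw] at hpair
        have hval : f j.1 ((ℬ.translate σ hσ).linkMap hi hj w) = f i.1 w :=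
          (hlink _ (ℬ.linkAt_mem_translateLinks σ hσ i j y hi hj)).2.2 w hw
        rw [hEw] at hval
        have haw : (k : ℚ) * f i.1 w ≤ toRat (a : Fin (ℬ.n i.1) → ℤ) ⬝ᵥ w := by
          have hwsupp : w ∈ (R i.1).support := by rw [hsuppR i.1]; exact hw.1
          obtain ⟨ρ, hρ, hwρ⟩ := Fan.mem_support.1 hwsupp
          have h1 := (mem_secMonoid_iff (R i.1) (m i.1)).1 (hsΓ i.1 a ha') ρ hρ w hwρ
          simp only at h1
          rw [sub_dotProduct, smul_dotProduct, smul_eq_mul, (hmprop i.1 ρ hρ).2.2 w hwρ,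
            sub_nonneg] at h1
          exact h1
        rw [hval, hpair]
        exact haw
      obtain ⟨g, hgF, hqg⟩ := LogBlowup.exists_add_mem_piece ((ℬ.translate σ hσ).P j) ((ℬ.translate σ hσ).faceAt j y hj)
        ((ℬ.translate σ hσ).faceAt_le j y hj) (R j.1) (hsuppR j.1) (m j.1) (f j.1) (fun ρ hρ x hx => (hmprop j.1 ρ hρ).2.2 x hx)
        k q hqface
      obtain ⟨b, hb, hz⟩ := hΓs j.1 _ hqg
      have hgP : g ∈ (ℬ.translate σ hσ).P j := (ℬ.translate σ hσ).faceAt_le j y hj hgF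
      set z : (ℬ.translate σ hσ).P j := ⟨(q : Fin (ℬ.n j.1) → ℤ) + g - b, hz⟩ with hz_def
      have hsum : q + ⟨g, hgP⟩ = b + z := Subtype.ext (by
        simp only [AddMemClass.coe_add, hz_def]; abel)
      -- germs: `φ_j(q) φ_j(g) = φ_j(b) φ_j(z)` at `y`
      set γ := (X.presheaf.germ ((ℬ.translate σ hσ).U j : X.Opens) y hj).hom with hγ
      have hφ0 : (ℬ.translate σ hσ).φ j (Multiplicative.ofAdd q) * (ℬ.translate σ hσ).φ j (Multiplicative.ofAdd (⟨g, hgP⟩ : (ℬ.translate σ hσ).P j)) =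
          (ℬ.translate σ hσ).φ j (Multiplicative.ofAdd b) * (ℬ.translate σ hσ).φ j (Multiplicative.ofAdd z) := by
        have h0 : (ℬ.translate σ hσ).φ j (Multiplicative.ofAdd (q + ⟨g, hgP⟩)) = (ℬ.translate σ hσ).φ j (Multiplicative.ofAdd (b + z)) := by
          rw [hsum]
        rwa [ofAdd_add, ofAdd_add, map_mul, map_mul] at h0
      have hφ : γ ((ℬ.translate σ hσ).φ j (Multiplicative.ofAdd q)) * γ ((ℬ.translate σ hσ).φ j (Multiplicative.ofAdd (⟨g, hgP⟩ : (ℬ.translate σ hσ).P j))) =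
          γ ((ℬ.translate σ hσ).φ j (Multiplicative.ofAdd b)) * γ ((ℬ.translate σ hσ).φ j (Multiplicative.ofAdd z)) := by
        rw [← map_mul γ, ← map_mul γ, hφ0]
      have hug : IsUnit (γ ((ℬ.translate σ hσ).φ j (Multiplicative.ofAdd (⟨g, hgP⟩ : (ℬ.translate σ hσ).P j)))) :=
        ((ℬ.translate σ hσ).coe_mem_faceAt_iff hj ⟨g, hgP⟩).1 hgF
      obtain ⟨u, hu⟩ := hq
      -- `φ_i(a)_y = φ_j(b)_y · (φ_j(z)_y · u_g⁻¹ · u⁻¹)`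
      have hrew : (X.presheaf.germ ((ℬ.translate σ hσ).U i : X.Opens) y hi).hom ((ℬ.translate σ hσ).φ i (Multiplicative.ofAdd a)) =
          γ ((ℬ.translate σ hσ).φ j (Multiplicative.ofAdd b)) *
            (γ ((ℬ.translate σ hσ).φ j (Multiplicative.ofAdd z)) * ↑hug.unit⁻¹ * ↑u⁻¹) := by
        have h1 : (X.presheaf.germ ((ℬ.translate σ hσ).U i : X.Opens) y hi).hom ((ℬ.translate σ hσ).φ i (Multiplicative.ofAdd a)) =
            γ ((ℬ.translate σ hσ).φ j (Multiplicative.ofAdd q)) * ↑u⁻¹ := by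
          rw [← hu, Units.mul_inv_cancel_right]
        have h2 : γ ((ℬ.translate σ hσ).φ j (Multiplicative.ofAdd q)) =
            γ ((ℬ.translate σ hσ).φ j (Multiplicative.ofAdd b)) * γ ((ℬ.translate σ hσ).φ j (Multiplicative.ofAdd z)) * ↑hug.unit⁻¹ := by
          rw [← hφ, mul_assoc, IsUnit.mul_val_inv, mul_one]
        rw [h1, h2]; ring
      show (X.presheaf.germ ((ℬ.translate σ hσ).U i : X.Opens) y hi).hom ((ℬ.translate σ hσ).φ i (Multiplicative.ofAdd a)) * μ ∈ _
      rw [hrew, mul_assoc]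
      refine Set.mul_mem_mul ⟨b, Finset.mem_coe.2 hb, rfl⟩ ?_
      -- the second factor lies in `M_y`
      have hzM : γ ((ℬ.translate σ hσ).φ j (Multiplicative.ofAdd z)) ∈ chartStalkMonoid ((ℬ.translate σ hσ).U j : X.Opens) ((ℬ.translate σ hσ).φ j) y hj :=
        Submonoid.mem_sup_right ⟨_, ⟨Multiplicative.ofAdd z, rfl⟩, rfl⟩
      have hunit : ∀ v : (X.presheaf.stalk y)ˣ, (↑v : X.presheaf.stalk y) ∈
          chartStalkMonoid ((ℬ.translate σ hσ).U j : X.Opens) ((ℬ.translate σ hσ).φ j) y hj := fun v =>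
        Submonoid.mem_sup_left ((IsUnit.mem_submonoid_iff _).2 (Units.isUnit v))
      exact Submonoid.mul_mem _ (Submonoid.mul_mem _ (Submonoid.mul_mem _ hzM (hunit _)) (hunit _)) hμ
    apply (ℬ.translate σ hσ).map_germ_span_eq_of_mul_chartStalkMonoid_eq hi hj
    rw [(ℬ.translate σ hσ).compat i j y hi hj]
    exact le_antisymm (key i j hi hj) (by rw [← (ℬ.translate σ hσ).compat i j y hi hj]; exact key j i hj hi)
  · -- (3) regularity of the blow-up charts: Kato (10.3)
    haveI := (ℬ.translate σ hσ).isNoetherianRing i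
    obtain ⟨b, I, hQ⟩ := horth i.1 a ha
    exact LogRefinedChart.isRegularLocalRing_localization_chartAlgebra ((ℬ.translate σ hσ).fg i) ((ℬ.translate σ hσ).saturated i)
      ((ℬ.translate σ hσ).span_eq_top i) (fun 𝔭 _ => (ℬ.translate σ hσ).isLogRegularAt i 𝔭) hQ
      (LogChart.le_blowupChartMonoid ((ℬ.translate σ hσ).P i) (↑(s i.1)) a) (LogChart.blowupChart ((ℬ.translate σ hσ).P i) ((ℬ.translate σ hσ).φ i) (↑(s i.1)) a)
      (fun p => LogChart.blowupChart_of_mem ((ℬ.translate σ hσ).P i) ((ℬ.translate σ hσ).φ i) (↑(s i.1)) a p)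
      (LogChart.adjoin_range_blowupChart_eq_top ((ℬ.translate σ hσ).P i) ((ℬ.translate σ hσ).φ i) (↑(s i.1)) a)
      (fun L _ g hg => blowupAlgebra_exists_extend _ _ L g (hg a)) 𝔓


end LogRegularAtlas

end Literature.AlgebraicGeometry.Resolution

end
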